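import Literature.MathematicalPhysics.QuantumFieldTheory.Balaban1983to89.B7Eq99Concrete
import Literature.MathematicalPhysics.QuantumFieldTheory.Balaban1983to89.B8Eq115GaugeFixing

/-!
# B7 Sect. C, the gauge-fixing side at an arbitrary background `U₀`: the `k`-th order averaging of gauge
transformations (79)/(80), the solved axial gauge conditions (72) ⇔ (76), the identity (84), (81) ⇔ (87), and the
EXISTENCE AND UNIQUENESS of the gauge fixing — hence (88) `(\overline{U′U₀})^k(Ū₀^k)⁻¹ = U̿₁^k` for THE gauge-fixed
field, unconditionally (`B7Eq84Concrete`)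

Source: T. Bałaban, *Averaging operations for lattice gauge theories*, Commun. Math. Phys. **98** (1985) 17–51
[cite: Balaban1985Averaging], Sect. C pp. 29–31, formulas (64)–(88). Page numbers are journal pages; every quotation
below was read on the page renders (journal page = render page + 16).

## What this file is

`B7Eq99Concrete` (the parent leaf) certified the AVERAGING side of Sect. C at an arbitrary background: the site average
(78), the block averages (85) `\overline{R_{0,·}U₁^{(j)}}` (`wrec`), and (88)/(92) `Ũ′^k := (\overline{U′U₀})^k(Ū₀^k)⁻¹ = U̿₁^k`
UNDER THE HYPOTHESIS (87) "`u(y) = (\overline{R_{0,y}U₁^{(k)}})⁻¹` on `Ω^{(k)}`" (`B7Eq99Concrete.eq88_of_87`). This file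
certifies the GAUGE-FIXING side that produces (87): for `U′ = U₁^u` (moving frame (55) at `U₀`,
`B7Eq92Concrete.mgauge U₀ u U₁`),

* §1 the solved form of the block axial gauge conditions: "(R̄^j_{0,y}Ũ′^j)(Γ_{y,x}) =
  u(y)(R̄^j_{0,y}Ũ^j_1)(Γ_{y,x})(R̄^j_{0,y}u)⁻¹(x) = 1 (72)" ⇔ "(R̄^j_{0,x_{j+1}}u)(x_j) = u(x_{j+1})(R̄^j_{0,x_{j+1}}Ũ^j_1)(Γ_{x_{j+1},x_j})
  (76)" — pure group algebra (`eq72_iff_eq76`);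
* §2 the `k`-th order averaging operation for gauge transformations "(R̄₀u)(x₁) = (\overline{R(U₀)u})(x₁), x₁ ∈ Ω^{(1)}, (79)
  (\overline{R₀u}^{j+1})(x_{j+1}) = (\overline{R(Ū₀^j)\overline{R₀u}^j})(x_{j+1}), x_{j+1} ∈ Ω^{(j+1)}. (80)" (`uavg`), built on the
  one-step operation (78) `B7Eq99Concrete.R0avg`;
* §3 "(\overline{R₀u}^j)(x_j) = u(x_j)\overline{R_{0,x_j}U₁}^{(j)}, x_j ∈ Ω^{(j)}, (84)" under the gauge conditions (67) at the
  levels below (`eq84`); the equivalence of the averaging condition "(\overline{R₀u}^k)(y) = 1, y ∈ Ω^{(k)}. (81)" with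
  "u(y) = (\overline{R_{0,y}U₁^{(k)}})⁻¹. (87)" (`eq81_iff_eq87`, print's (86)); hence (88) under (67) + (81) (`eq88`);
* §4 "Thus the gauge transformation is uniquely determined by all the conditions and is given by the formulas (77) for
  `j = k − 1` and by (87)." (p. 31): an explicit gauge transformation `glev … k 0` on `ℤ^d` (downward recursion: (87) on
  `Ω^{(k)}`, then (76) block by block) satisfies (67) at every level `j < k` and (81) at level `k`
  (`gaugeFixing_exists`), any two such gauge transformations are equal (`gaugeFixing_unique`), and for it (88)/(92) hold
  with no hypothesis left (`eq88_glev`, `avgIter_glev`);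
* §5 (v1.1) the telescoped multi-level contour formula (77) "R(U₀(Γ^{(j+1)}_{x_{j+1},x}))u(x) = … =
  u(x_{j+1})(R_{0,x_{j+1}}U₁)(Γ^{(j+1)}_{x_{j+1},x}), x ∈ B^{j+1}(x_{j+1}), (77)" with print's telescoped transporter
  "U₀(Γ^{(j)}_{x_j,x}) = Ū₀^{j−1}(Γ_{x_j,x_{j−1}})·…·Ū₀(Γ_{x₂,x₁})U₀(Γ_{x₁,x})" (p. 29) (`telHol`, `telTw`, `eq77` at every level
  `m ≤ k` under (67)), and the closed formula "(77) for `j = k − 1` and (87)" for the gauge fixing (`gauge_formula`), which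
  the §4 construction satisfies (`glev_formula`).

Everything is kernel-proved algebra over the unit group `𝔸ˣ` of a complex Banach algebra (§1 over any group), on the
infinite lattice `ℤ^d`, for block size `L ≥ 1` in §4. NO analytic input (smallness, unitarity, positivity) is used.

## Dictionary (print ↦ Lean)

* gauge field `U₀`, `U₁` on bonds ↦ `U₀ U₁ : Site d → Fin d → 𝔸ˣ`; gauge transformation `u` ↦ `u : Site d → 𝔸ˣ`; `U₁^u` in
  the moving frame (55) at `U₀` ↦ `mgauge U₀ u U₁` (`B7Eq92Concrete`); `u` read on `Ω^{(j)} ≅ ℤ^d` ↦ `uLev L u j`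
  (`B7AvgGaugeCovariance`, `u_j(z) = u(L^j z)`).
* `Ū₀^j` ↦ `avgIter L U₀ j` (`B7Prop2Explicit`); `Ũ′^j = (\overline{U′U₀})^j(Ū₀^j)⁻¹` (65)/(68)/(69) ↦ `tildIter L U₀ U′ j`,
  `Ũ₁^j` ↦ `tildIter L U₀ U₁ j`; `U̿₁^j` (90)/(91) ↦ `dbavgCovIter L U₀ U₁ j` (`B7Eq92Concrete`).
* `R(X)Y = XYX⁻¹` (56) ↦ `Rc X Y`; `(R^j_{0,y}v)(x) = R(Ū₀^j(Γ_{y,x}))v(x)` ↦ `R0fun (avgIter L U₀ j) y v x`; the transporter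
  `(R̄^j_{0,y}W)(Γ_{y,x})` ↦ `tHol (avgIter L U₀ j) W y (treeWord (x − y))`; `Γ_{y,x}` = the tree contour `treeWord (x − y)`
  (`B7Prop1Explicit`).
* blocks: `y = x_{j+1} ∈ Ω^{(j+1)}` in level-`j` coordinates ↦ `(L : ℤ) • z`; `x ∈ B(y)` ↦ `x = (L : ℤ) • z + boxVec L r`,
  `r : Fin d → Fin L`; conversely `z = fl L x`, `r = brem L hL x` (§4, Euclidean division, `L ≥ 1`).
* the one-step averaging (78) `(\overline{R(V₀)v})(y)` ↦ `R0avg L V₀ v y = savg L (R0fun V₀ y v) y` (`B7Eq99Concrete`);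
  `\overline{R₀u}^j` (79)/(80) ↦ `uavg L U₀ u j`; `\overline{R_{0,x_j}U₁}^{(j)}` (85) ↦ `wrec L U₀ U₁ j` (`B7Eq99Concrete`).
* the gauge conditions (64)/(66)/(67) for `U′ = U₁^u`, levels `j < k` ↦ the predicate `AxialGauge L U₀ U₁ u k`; the
  averaging condition (81) ↦ `∀ z, uavg L U₀ u k z = 1`; the gauge fixing ↦ `glev L hL U₀ U₁ k 0` (its level-`j` reading
  `glev L hL U₀ U₁ k j`, `uLev_glev`).

## Certified here (kernel)

`eq72_iff_eq76` (72) ⇔ (73)/(74)/(76); `uavg` (79)/(80) with `uavg_one` = (79); `eq84` (84) for all `j ≤ k` under (67)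
(cases (82), (83)); `eq81_iff_eq87` (81) ⇔ (86) ⇔ (87); `eq88`, `avgIter_eq_of_gauge` (88)/(92) under (67) + (81);
`gaugeFixing_exists`, `gaugeFixing_unique` (p. 31, first sentence after (87)); `eq88_glev`, `avgIter_glev` (88) for the
gauge-fixed field, unconditionally; (v1.1, §5) `telHol` = print's `U₀(Γ^{(m)}_{x_m,x})`, `telTw` = print's symbol
`(R_{0,x_m}U₁)(Γ^{(m)}_{x_m,x})`, `telRot_succ` (the composite-rotation identity before (77)), `eq77` = (77) at every level
`m ≤ k` under (67), `gauge_formula` = "(77) for `j = k − 1` and (87)", `glev_formula`.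

## NOT certified here

In (77) the FIRST middle expression (the iterated operator symbols `R̄^j_{0,x_{j+1}}·…·R̄_{0,x₂}` acting on everything to
their right) is notation for the second (explicit rotations), which is the one formalised (`telTw`, generated by the
recursion `telTw_succ` via the multiplicativity (56)/(57) of `R`); the `k = 1` formula (63) and the notation (89);
finite periodic lattices (we work on `ℤ^d`; no wrap-around); any ANALYTIC property of the averages
(U(N)-valuedness, small-field bounds, Props. 3–7) — none is used. The printed side condition "`x ≠ y`" in (64)/(66)/(67) is
dropped: at `x = y` the condition reads `1 = 1` (`tHol_nil`), so stating it at all block points is equivalent.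

ABSOLUTE RULE: no statement of the paper enters as a cited fact; (67) and (81) appear only as HYPOTHESES (the predicate
`AxialGauge`, the equations `uavg … k z = 1`) or as proved properties of the constructed `glev`. Tree API used, by name:
`B7Eq99Concrete` (`R0fun`, `R0fun_apply`, `R0fun_add`, `R0fun_self`, `savg`, `savg_apply`, `Sexp_apply`, `savg_const_mul`,
`R0avg`, `R0avg_one_left`, `wrec`, `wrec_succ`, `wrec_one`, `eq88_of_87`, `avgIter_eq_of_87`), `B7Eq92Concrete` (`Rc`, `Rc_apply`,
`Rc_mul`, `Rc_inv_apply`, `Rc_one_apply`, `mgauge`, `tHol`, `tHol_nil`, `tHol_mgauge`, `tildIter`, `tildIter_mgauge`, `dbavgCovIter`,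
`wframe`, `avgIter_one`), `B7Prop1Explicit` (`hol`, `hol_nil`, `treeWord`, `treeWord_zero`, `disp_treeWord`, `boxVec`, `Site`),
`B7Prop2Explicit` (`avgIter`, `avgIter_zero`), `B7AvgGaugeCovariance` (`uLev`, `uLev_zero`, `uLev_smul`), `B8Ineq130` (`fl`, the
coarse site below `x`), `B8Eq115GaugeFixing` (`fl_smul`, `fl_block`).

RELATION TO `B8Eq115GaugeFixing` (B8 (1.14)/(1.15)): that leaf fixes the PLAIN block axial gauge `Ū^{j}(Γ_{x_{j+1},x_j}) = 1`
of the field itself with `u = 1` on the top lattice — the case `U₀ = 1` of (64)–(67) with B8's condition (1.14) in place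
of the averaging condition (81). Here the gauge is RELATIVE to an arbitrary background `U₀` (moving frame, rotations
`R(Ū₀^j(Γ))`) and the top condition is (81); the two constructions share only the block geometry (`fl`).

VERSIONS: v1 = p191199 (commit 9032fd53bffc; §§1–4, 31 theorems + 5 definitions). v1.1 (this file) is APPEND-ONLY: the new
§5 (`telHol`, `telTw`, `telHol_zero/succ`, `telTw_zero/succ`, `telRot_succ`, `eq77`, `gauge_formula`, `glev_formula`) certifies
the telescoped formula (77) and print's closed form "(77) for `j = k − 1` and (87)" of the gauge fixing, previously listed as
not certified; no v1 declaration, statement or proof is changed (only this module docstring is extended, and the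
stale parenthesis "the EXISTENCE of such a `u` … is not formalised here" in the docstring of `eq88` — existence IS §4 — is
corrected).
-/

noncomputable section

open NormedSpace Finset

namespace Literature.MathematicalPhysics.QuantumFieldTheory.Balaban1983to89.B7Eq84Concrete

open B7Prop1Explicit B7Prop2Explicit B7Prop3Flat B7Prop4Flat MatrixLog B7AvgGaugeCovariance B7Prop6Flat
open B7Eq92Concrete B7Eq99Concrete
open B8Ineq130 (fl)
open B8Eq115GaugeFixing (fl_smul fl_block)

-- `Site` alone would resolve to the torus sites of `Setup.lean`; re-export the `ℤ^d` sites of `B7Prop1Explicit`.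
export B7Prop1Explicit (Site)

variable {d : ℕ}

/-! ## §1 The solved gauge conditions: (72) ⇔ (73)–(76), over a group -/

section Solved

variable {G : Type*} [Group G]

/-- `R0fun_mul`: the rotation `(R_{0,y}·)(x)` is multiplicative in the site function (`R(X)Y = XYX⁻¹` (56) is an inner
automorphism). [cite: Balaban1985Averaging, (56) p.27] -/
theorem R0fun_mul (V₀ : Site d → Fin d → G) (y : Site d) (a b : Site d → G) (x : Site d) :
    R0fun V₀ y (fun z => a z * b z) x = R0fun V₀ y a x * R0fun V₀ y b x := by
  simp only [R0fun_apply, map_mul]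

/-- **(72) ⇔ (73)–(76)** p. 29: the block axial gauge condition for `V′ = W^v` (moving frame (55) at `V₀`),
"(R̄^j_{0,y}Ũ′^j)(Γ_{y,x}) = u(y)(R̄^j_{0,y}Ũ^j_1)(Γ_{y,x})(R̄^j_{0,y}u)⁻¹(x) = 1 (72)", is equivalent to its solved form
"(R̄^j_{0,x_{j+1}}u)(x_j) = u(x_{j+1})(R̄^j_{0,x_{j+1}}Ũ^j_1)(Γ_{x_{j+1},x_j}) for x_j ∈ B(x_{j+1}), x_{j+1} ∈ Ω^{(j+1)}. (76)" ((73), (74) are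
the cases `j = 0, 1`); the first
equality of (72) is the transporter covariance `B7Eq92Concrete.tHol_mgauge`. Pure group algebra, for every frame `v`,
configuration `W`, background `V₀` and sites `y`, `x`. [cite: Balaban1985Averaging, (72)–(76) p.29, (60) p.27] -/
theorem eq72_iff_eq76 (V₀ W : Site d → Fin d → G) (v : Site d → G) (y x : Site d) :
    tHol V₀ (mgauge V₀ v W) y (treeWord (x - y)) = 1 ↔ R0fun V₀ y v x = v y * tHol V₀ W y (treeWord (x - y)) := by
  rw [tHol_mgauge, disp_treeWord, add_sub_cancel, ← R0fun_apply, mul_inv_eq_one, eq_comm]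

end Solved

/-! ## §2 Block-point congruence of the site average (78) and the `k`-th order averaging (79)/(80) -/

section Averaging

variable {𝔸 : Type*} [NormedRing 𝔸] [NormedAlgebra ℂ 𝔸] [CompleteSpace 𝔸]

omit [CompleteSpace 𝔸] in
/-- The exponent (78) depends on `g` only through its values at the centre `y` and at the block points `y + r`,
`r ∈ [0, L)^d`. [cite: Balaban1985Averaging, (78) p.30] -/
theorem Sexp_congr (L : ℕ) {g g' : Site d → 𝔸ˣ} {y : Site d} (h0 : g y = g' y)
    (h : ∀ r : Fin d → Fin L, g (y + boxVec L r) = g' (y + boxVec L r)) : Sexp L g y = Sexp L g' y := by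
  simp only [Sexp_apply, h0, h]

/-- The site average (78) `{g(x)}_{x∈B(y)}` depends on `g` only through `g(y)` and the block values `g(y + r)`.
[cite: Balaban1985Averaging, (78) p.30] -/
theorem savg_congr (L : ℕ) {g g' : Site d → 𝔸ˣ} {y : Site d} (h0 : g y = g' y)
    (h : ∀ r : Fin d → Fin L, g (y + boxVec L r) = g' (y + boxVec L r)) : savg L g y = savg L g' y := by
  rw [savg_apply, savg_apply, Sexp_congr L h0 h, h0]

/-- **(79)/(80)** p. 30, the `k`-th order averaging operation for gauge transformations at the background `U₀`:
"(R̄₀u)(x₁) = (\overline{R(U₀)u})(x₁), x₁ ∈ Ω^{(1)}, (79) (\overline{R₀u}^{j+1})(x_{j+1}) = (\overline{R(Ū₀^j)\overline{R₀u}^j})(x_{j+1}),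
x_{j+1} ∈ Ω^{(j+1)}. (80)" — iterate the twisted site average (78) at the successive averaged backgrounds `Ū₀^j`
(`avgIter L U₀ j`), rescaling `Ω^{(j+1)} ≅ ℤ^d` at each step; `\overline{R₀u}^0 := u`.
[cite: Balaban1985Averaging, (79)–(80) p.30, (78) p.30] -/
def uavg (L : ℕ) (U₀ : Site d → Fin d → 𝔸ˣ) (u : Site d → 𝔸ˣ) : ℕ → Site d → 𝔸ˣ
  | 0 => u
  | j + 1 => fun z => R0avg L (avgIter L U₀ j) (uavg L U₀ u j) ((L : ℤ) • z)

/-- `uavg_zero`: `\overline{R₀u}^0 = u`. [cite: Balaban1985Averaging, (79) p.30] -/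
@[simp] theorem uavg_zero (L : ℕ) (U₀ : Site d → Fin d → 𝔸ˣ) (u : Site d → 𝔸ˣ) : uavg L U₀ u 0 = u := rfl

/-- `uavg_succ`: (80) unfolded. [cite: Balaban1985Averaging, (80) p.30] -/
theorem uavg_succ (L : ℕ) (U₀ : Site d → Fin d → 𝔸ˣ) (u : Site d → 𝔸ˣ) (j : ℕ) (z : Site d) :
    uavg L U₀ u (j + 1) z = R0avg L (avgIter L U₀ j) (uavg L U₀ u j) ((L : ℤ) • z) := rfl

/-- `uavg_one` = (79): `(R̄₀u)(x₁) = (\overline{R(U₀)u})(x₁)`, the twisted site average (78) at `U₀` read on `Ω^{(1)}`.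
[cite: Balaban1985Averaging, (79) p.30] -/
theorem uavg_one (L : ℕ) (U₀ : Site d → Fin d → 𝔸ˣ) (u : Site d → 𝔸ˣ) (z : Site d) :
    uavg L U₀ u 1 z = R0avg L U₀ u ((L : ℤ) • z) := by
  rw [uavg_succ, avgIter_zero]
  rfl

/-! ## §3 (84) under the block axial gauge (67), (81) ⇔ (87), and (88) under (67) + (81) -/

/-- The block axial gauge conditions (64)/(66)/(67) p. 29 for `U′ = U₁^u` (moving frame at `U₀`) at the levels `j < k`:
"(R̄^j_{0,y}Ũ′^j)(Γ_{y,x}) = 1, x ∈ B(y), x ≠ y, y ∈ Ω^{(j+1)}, (67)" — `Ũ′^j = tildIter L U₀ (mgauge U₀ u U₁) j` (69), the block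
`B(y) = y + [0, L)^d` of level-`j` sites around `y = Lz`, `Γ_{y,x} = treeWord (x − y)`; at `x = y` the condition is automatic
(`tHol_nil`), so it is stated for all block points. A PREDICATE (hypothesis of (84), (87), (88) below), not a fact.
[cite: Balaban1985Averaging, (64) p.29, (66) p.29, (67) p.29] -/
def AxialGauge (L : ℕ) (U₀ U₁ : Site d → Fin d → 𝔸ˣ) (u : Site d → 𝔸ˣ) (k : ℕ) : Prop :=
  ∀ j < k, ∀ (z : Site d) (r : Fin d → Fin L),
    tHol (avgIter L U₀ j) (tildIter L U₀ (mgauge U₀ u U₁) j) ((L : ℤ) • z) (treeWord (boxVec L r)) = 1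

/-- `AxialGauge` is monotone in the number of levels. [cite: Balaban1985Averaging, (67) p.29] -/
theorem AxialGauge.mono {L : ℕ} {U₀ U₁ : Site d → Fin d → 𝔸ˣ} {u : Site d → 𝔸ˣ} {k k' : ℕ} (h : AxialGauge L U₀ U₁ u k)
    (hk : k' ≤ k) : AxialGauge L U₀ U₁ u k' :=
  fun j hj z r => h j (lt_of_lt_of_le hj hk) z r

/-- **(67) ⇒ (76)** at the block points: under the axial gauge at level `j`, the rotated gauge function read at level `j`
satisfies "(R̄^j_{0,x_{j+1}}u)(x_j) = u(x_{j+1})(R̄^j_{0,x_{j+1}}Ũ^j_1)(Γ_{x_{j+1},x_j}) for x_j ∈ B(x_{j+1}), x_{j+1} ∈ Ω^{(j+1)}. (76)"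
(`u` at level `j` is `uLev L u j`, by (70)/(71) `B7Eq92Concrete.tildIter_mgauge`). [cite: Balaban1985Averaging, (76) p.29, (71) p.29] -/
theorem eq76_of_axialGauge (L : ℕ) (U₀ U₁ : Site d → Fin d → 𝔸ˣ) (u : Site d → 𝔸ˣ) {k j : ℕ}
    (hax : AxialGauge L U₀ U₁ u k) (hj : j < k) (z : Site d) (r : Fin d → Fin L) :
    R0fun (avgIter L U₀ j) ((L : ℤ) • z) (uLev L u j) ((L : ℤ) • z + boxVec L r)
      = uLev L u j ((L : ℤ) • z)
        * tHol (avgIter L U₀ j) (tildIter L U₀ U₁ j) ((L : ℤ) • z) (treeWord (boxVec L r)) := by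
  have h := hax j hj z r
  rw [tildIter_mgauge] at h
  have h' := (eq72_iff_eq76 (avgIter L U₀ j) (tildIter L U₀ U₁ j) (uLev L u j) ((L : ℤ) • z)
    ((L : ℤ) • z + boxVec L r)).1
  rw [add_sub_cancel_left] at h'
  exact h' h

/-- **(84)** p. 30: "We easily find by induction that (\overline{R₀u}^j)(x_j) = u(x_j)\overline{R_{0,x_j}U₁}^{(j)}, x_j ∈ Ω^{(j)}, (84)"
— under the block axial gauge (67) at the levels `j < k`, the `j`-th order average (79)/(80) of the gauge function is the
gauge function read at level `j` times the block average (85) `\overline{R_{0,·}U₁^{(j)}}` (`B7Eq99Concrete.wrec`), for all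
`j ≤ k` ((82), (83) are the cases `j = 1, 2`). Inputs, as printed: (76) (from (67)), the multiplicativity of `R` (57) and the
left-invariance of the site average (78). [cite: Balaban1985Averaging, (84) p.30, (82)–(83) p.30, (85) p.31] -/
theorem eq84 (L : ℕ) (U₀ U₁ : Site d → Fin d → 𝔸ˣ) (u : Site d → 𝔸ˣ) {k : ℕ} (hax : AxialGauge L U₀ U₁ u k) :
    ∀ j ≤ k, uavg L U₀ u j = fun z => uLev L u j z * wrec L U₀ U₁ j z
  | 0, _ => by
    funext z
    simp
  | j + 1, hj => by
    have hjk : j < k := Nat.lt_of_succ_le hj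
    funext z
    rw [uavg_succ, eq84 L U₀ U₁ u hax j hjk.le, R0avg, wrec_succ, ← uLev_smul L u j z, ← savg_const_mul]
    apply savg_congr
    · simp only [R0fun_self, sub_self, treeWord_zero, tHol_nil, one_mul]
    · intro r
      rw [R0fun_mul, eq76_of_axialGauge L U₀ U₁ u hax hjk z r, add_sub_cancel_left, mul_assoc]

/-- (84) at the top level `j = k`, pointwise. [cite: Balaban1985Averaging, (84) p.30] -/
theorem eq84_top (L : ℕ) (U₀ U₁ : Site d → Fin d → 𝔸ˣ) (u : Site d → 𝔸ˣ) {k : ℕ} (hax : AxialGauge L U₀ U₁ u k)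
    (z : Site d) : uavg L U₀ u k z = uLev L u k z * wrec L U₀ U₁ k z := by
  rw [eq84 L U₀ U₁ u hax k le_rfl]

/-- **(81) ⇔ (86) ⇔ (87)** p. 30–31: under the axial gauge (67), the averaging condition "(\overline{R₀u}^k)(y) = 1, y ∈ Ω^{(k)}. (81)"
is equivalent to "u(y) = (\overline{R_{0,y}U₁^{(k)}})⁻¹. (87)" (via (84): "(\overline{R₀u^k})(y) = u(y)\overline{R_{0,y}U₁^{(k)}} = 1 for
y ∈ Ω^{(k)}, (86)") —
the values of `u` on `Ω^{(k)}` are uniquely determined. [cite: Balaban1985Averaging, (81) p.30, (86)–(87) p.31] -/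
theorem eq81_iff_eq87 (L : ℕ) (U₀ U₁ : Site d → Fin d → 𝔸ˣ) (u : Site d → 𝔸ˣ) {k : ℕ} (hax : AxialGauge L U₀ U₁ u k)
    (z : Site d) : uavg L U₀ u k z = 1 ↔ uLev L u k z = (wrec L U₀ U₁ k z)⁻¹ := by
  rw [eq84_top L U₀ U₁ u hax z, mul_eq_one_iff_eq_inv]

/-- **(88) UNDER THE PRINTED GAUGE CONDITIONS** p. 31: if `U′ = U₁^u` (moving frame at `U₀`) satisfies the block axial gauge
conditions (64)/(66)/(67) at the levels `j < k` and the averaging condition (81) at level `k`, then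
"Ū^k_b(Ū₀^k)_b⁻¹ = (\overline{U′U₀}^k)_b(Ū₀^k)_b⁻¹ = u(b₋)(\overline{U₁U₀}^k)_b(Ū₀^k)_b⁻¹R̄^k_{0,b}u⁻¹(b₊) = (\overline{R_{0,b₋}U₁^{(k)}})⁻¹Ũ₁^kR̄^k_{0,b}\overline{R_{0,b₊}U₁^{(k)}},
b ⊂ Ω^{(k)}. (88)" `= (U̿₁^k)_b` (92): the `k`-fold average of the gauge-fixed field relative to the background IS the explicit double-bar average (90)/(91)
`B7Eq92Concrete.dbavgCovIter`. (The EXISTENCE of such a `u` is §4, `gaugeFixing_exists`/`eq88_glev`; its closed form — print's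
"(77) for `j = k − 1` and (87)" — is §5, `gauge_formula`.)
[cite: Balaban1985Averaging, (88) p.31, (81) p.30, (67) p.29, (92) p.31] -/
theorem eq88 (L : ℕ) (U₀ U₁ : Site d → Fin d → 𝔸ˣ) (u : Site d → 𝔸ˣ) (k : ℕ) (hax : AxialGauge L U₀ U₁ u k)
    (h81 : ∀ z : Site d, uavg L U₀ u k z = 1) :
    tildIter L U₀ (mgauge U₀ u U₁) k = dbavgCovIter L U₀ U₁ k :=
  eq88_of_87 L U₀ U₁ u k fun z => (eq81_iff_eq87 L U₀ U₁ u hax z).1 (h81 z)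

/-- (88)/(43) for the full average under (67) + (81): `(\overline{U′U₀})^k = U̿₁^k·Ū₀^k` — in the block axial gauge with the
averaging condition, NO frame is left over in the `k`-fold average. [cite: Balaban1985Averaging, (88) p.31, (43) p.23] -/
theorem avgIter_eq_of_gauge (L : ℕ) (U₀ U₁ : Site d → Fin d → 𝔸ˣ) (u : Site d → 𝔸ˣ) (k : ℕ)
    (hax : AxialGauge L U₀ U₁ u k) (h81 : ∀ z : Site d, uavg L U₀ u k z = 1) :
    avgIter L (mgauge U₀ u U₁ * U₀) k = dbavgCovIter L U₀ U₁ k * avgIter L U₀ k :=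
  avgIter_eq_of_87 L U₀ U₁ u k fun z => (eq81_iff_eq87 L U₀ U₁ u hax z).1 (h81 z)

/-! ### Flat reduction and the first instances -/

/-- At `U₀ = 1` the averaging (79)/(80) is the iterated plain site average (78) (no rotations).
[cite: Balaban1985Averaging, (79)–(80) p.30] -/
theorem uavg_succ_one_left (L : ℕ) (u : Site d → 𝔸ˣ) (j : ℕ) (z : Site d) :
    uavg L (1 : Site d → Fin d → 𝔸ˣ) u (j + 1) z = savg L (uavg L 1 u j) ((L : ℤ) • z) := by
  rw [uavg_succ, avgIter_one, R0avg_one_left]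

/-- **(82)** as the case `j = 1` of (84): under (64), `(R̄₀u)(x₁) = u(x₁)\overline{R_{0,x₁}U₁}`.
[cite: Balaban1985Averaging, (82) p.30, (64) p.29] -/
example (L : ℕ) (U₀ U₁ : Site d → Fin d → 𝔸ˣ) (u : Site d → 𝔸ˣ) {k : ℕ} (hax : AxialGauge L U₀ U₁ u k) (hk : 1 ≤ k)
    (z : Site d) : R0avg L U₀ u ((L : ℤ) • z) = u ((L : ℤ) • z) * wframe L U₀ U₁ ((L : ℤ) • z) := by
  rw [← uavg_one, congrFun (eq84 L U₀ U₁ u hax 1 hk) z, wrec_one, ← uLev_smul, uLev_zero]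

/-! ## §4 Existence and uniqueness of the gauge fixing: "Thus the gauge transformation is uniquely determined by all the
conditions and is given by the formulas (77) for `j = k − 1` and by (87)." (p. 31) — over `ℤ^d`, for `L ≥ 1` -/

section GaugeFixing

/-- The zero position in a block, `r = 0 ∈ [0, L)^d` (needs `L ≥ 1`). [folklore] -/
def bzero {L : ℕ} (hL : 1 ≤ L) : Fin d → Fin L := fun _ => ⟨0, hL⟩

omit [NormedAlgebra ℂ 𝔸] [CompleteSpace 𝔸] in
/-- `boxVec L 0 = 0`. [folklore] -/
@[simp] theorem boxVec_bzero {L : ℕ} (hL : 1 ≤ L) : boxVec L (bzero (d := d) hL) = 0 := by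
  funext κ; simp [boxVec, bzero]

/-- Coordinatewise Euclidean remainder: the position `r ∈ [0, L)^d` of `x` in its block, `x = L·fl x + r` (blocks
`B(y) = y + [0, L)^d`, `y ∈ LΩ`, as in (78) p. 30). [cite: Balaban1985Averaging, (78) p.30] -/
def brem (L : ℕ) (hL : 1 ≤ L) (x : Site d) : Fin d → Fin L := fun κ =>
  ⟨(x κ % (L : ℤ)).toNat, by
    have h1 : 0 ≤ x κ % (L : ℤ) := Int.emod_nonneg _ (by exact_mod_cast (Nat.one_le_iff_ne_zero.mp hL))
    have h2 : x κ % (L : ℤ) < (L : ℤ) := Int.emod_lt_of_pos _ (by exact_mod_cast hL)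
    omega⟩

omit [NormedAlgebra ℂ 𝔸] [CompleteSpace 𝔸] in
/-- Every site lies in exactly one block at each level: `x = L·fl x + brem x` (`B8Ineq130.fl L x = (x_κ div L)_κ` is the
coarse site below `x`; cf. `B8Eq115GaugeFixing.exists_block`, here with the explicit remainder). [folklore] -/
theorem fl_decomp {L : ℕ} (hL : 1 ≤ L) (x : Site d) : (L : ℤ) • fl L x + boxVec L (brem L hL x) = x := by
  funext κ
  have h1 : 0 ≤ x κ % (L : ℤ) := Int.emod_nonneg _ (by exact_mod_cast (Nat.one_le_iff_ne_zero.mp hL))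
  simp only [Pi.add_apply, Pi.smul_apply, smul_eq_mul, fl, boxVec, brem, Int.toNat_of_nonneg h1]
  linarith [Int.emod_def (x κ) (L : ℤ)]

omit [NormedAlgebra ℂ 𝔸] [CompleteSpace 𝔸] in
/-- `brem (Lz + r) = r` for `r ∈ [0, L)^d`. [folklore] -/
theorem brem_block {L : ℕ} (hL : 1 ≤ L) (z : Site d) (r : Fin d → Fin L) :
    brem L hL ((L : ℤ) • z + boxVec L r) = r := by
  funext κ
  apply Fin.ext
  have h0 : (0 : ℤ) ≤ ((r κ : ℕ) : ℤ) := by positivity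
  have h1 : ((r κ : ℕ) : ℤ) < (L : ℤ) := by exact_mod_cast (r κ).isLt
  simp only [brem, Pi.add_apply, Pi.smul_apply, smul_eq_mul, boxVec]
  rw [add_comm, Int.add_mul_emod_self_left, Int.emod_eq_of_lt h0 h1]
  simp

omit [NormedAlgebra ℂ 𝔸] [CompleteSpace 𝔸] in
/-- `brem (Lz) = 0`. [folklore] -/
theorem brem_centre {L : ℕ} (hL : 1 ≤ L) (z : Site d) : brem L hL ((L : ℤ) • z) = bzero hL := by
  simpa using brem_block hL z (bzero hL)

/-- **The level functions of the gauge fixing**, by DOWNWARD recursion from level `k` (print: "Taking (77) for `j = k − 1`,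
we may determine the gauge transformation `u` uniquely, given values `u(y)` at points `y` of the lattice `Ω^{(k)}`", p. 30,
and (87) p. 31 for those values): at level `k`, `u_k := (\overline{R_{0,·}U₁^{(k)}})⁻¹` (87); at a level `j < k`, the solved
axial gauge condition (76) read as a definition, `u_j(x) := R(Ū₀^j(Γ_{y,x}))⁻¹[u_{j+1}(z)·(R̄^j_{0,y}Ũ₁^j)(Γ_{y,x})]` for `x` in the
block of `y = Lz` (`z = fl x`, `x − y = brem x`). `glev … k j` is `u` read at level `j`; the gauge transformation itself is
`glev … k 0`. [cite: Balaban1985Averaging, (76)–(77) p.29–30, (87) p.31] -/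
def glev (L : ℕ) (hL : 1 ≤ L) (U₀ U₁ : Site d → Fin d → 𝔸ˣ) (k : ℕ) (j : ℕ) : Site d → 𝔸ˣ :=
  if _h : j < k then fun x =>
    Rc (hol (avgIter L U₀ j) ((L : ℤ) • fl L x) (treeWord (boxVec L (brem L hL x))))⁻¹
      (glev L hL U₀ U₁ k (j + 1) (fl L x)
        * tHol (avgIter L U₀ j) (tildIter L U₀ U₁ j) ((L : ℤ) • fl L x) (treeWord (boxVec L (brem L hL x))))
  else fun x => (wrec L U₀ U₁ k x)⁻¹
termination_by k - j
decreasing_by omega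

/-- `glev` below the top level: (76) as a definition. [cite: Balaban1985Averaging, (76) p.29] -/
theorem glev_of_lt (L : ℕ) (hL : 1 ≤ L) (U₀ U₁ : Site d → Fin d → 𝔸ˣ) {k j : ℕ} (h : j < k) (x : Site d) :
    glev L hL U₀ U₁ k j x
      = Rc (hol (avgIter L U₀ j) ((L : ℤ) • fl L x) (treeWord (boxVec L (brem L hL x))))⁻¹
          (glev L hL U₀ U₁ k (j + 1) (fl L x)
            * tHol (avgIter L U₀ j) (tildIter L U₀ U₁ j) ((L : ℤ) • fl L x) (treeWord (boxVec L (brem L hL x)))) := by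
  rw [glev, dif_pos h]

/-- `glev` at the top level `j = k`: (87) as a definition, `u_k = (\overline{R_{0,·}U₁^{(k)}})⁻¹`.
[cite: Balaban1985Averaging, (87) p.31] -/
theorem glev_top (L : ℕ) (hL : 1 ≤ L) (U₀ U₁ : Site d → Fin d → 𝔸ˣ) (k : ℕ) (x : Site d) :
    glev L hL U₀ U₁ k k x = (wrec L U₀ U₁ k x)⁻¹ := by
  rw [glev, dif_neg (lt_irrefl k)]

/-- Consistency across levels: at a block centre `y = Lz` the level-`j` function is the level-`(j+1)` function,
`u_j(Lz) = u_{j+1}(z)` ((76) at `x_j = x_{j+1}` is trivial: `Γ_{y,y} = ∅`). [cite: Balaban1985Averaging, (76) p.29] -/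
theorem glev_centre (L : ℕ) (hL : 1 ≤ L) (U₀ U₁ : Site d → Fin d → 𝔸ˣ) {k j : ℕ} (h : j < k) (z : Site d) :
    glev L hL U₀ U₁ k j ((L : ℤ) • z) = glev L hL U₀ U₁ k (j + 1) z := by
  rw [glev_of_lt L hL U₀ U₁ h, fl_smul hL, brem_centre hL, boxVec_bzero, treeWord_zero, tHol_nil, mul_one,
    hol_nil, inv_one, Rc_one_apply]

/-- The gauge transformation `u := glev … k 0` read at level `j ≤ k` IS the level-`j` function: `u_j = glev … k j`
(by the consistency `glev_centre`). [cite: Balaban1985Averaging, (77) p.30] -/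
theorem uLev_glev (L : ℕ) (hL : 1 ≤ L) (U₀ U₁ : Site d → Fin d → 𝔸ˣ) (k : ℕ) :
    ∀ j ≤ k, uLev L (glev L hL U₀ U₁ k 0) j = glev L hL U₀ U₁ k j
  | 0, _ => uLev_zero _ _
  | j + 1, hj => by
    funext z
    rw [← uLev_smul, uLev_glev L hL U₀ U₁ k j (Nat.le_of_succ_le hj)]
    exact glev_centre L hL U₀ U₁ (Nat.lt_of_succ_le hj) z

/-- The level functions satisfy the solved gauge condition (76) on every block. [cite: Balaban1985Averaging, (76) p.29] -/
theorem glev_block (L : ℕ) (hL : 1 ≤ L) (U₀ U₁ : Site d → Fin d → 𝔸ˣ) {k j : ℕ} (h : j < k) (z : Site d)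
    (r : Fin d → Fin L) :
    R0fun (avgIter L U₀ j) ((L : ℤ) • z) (glev L hL U₀ U₁ k j) ((L : ℤ) • z + boxVec L r)
      = glev L hL U₀ U₁ k (j + 1) z
        * tHol (avgIter L U₀ j) (tildIter L U₀ U₁ j) ((L : ℤ) • z) (treeWord (boxVec L r)) := by
  rw [R0fun_apply, add_sub_cancel_left, glev_of_lt L hL U₀ U₁ h, fl_block hL, brem_block hL]
  exact (Rc_inv_apply _ _).2

/-- **Existence, gauge conditions**: `U₁^u` with `u := glev … k 0` satisfies the block axial gauge conditions (64)/(66)/(67)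
at every level `j < k`. [cite: Balaban1985Averaging, (67) p.29, (76)–(77) p.29–30] -/
theorem axialGauge_glev (L : ℕ) (hL : 1 ≤ L) (U₀ U₁ : Site d → Fin d → 𝔸ˣ) (k : ℕ) :
    AxialGauge L U₀ U₁ (glev L hL U₀ U₁ k 0) k := by
  intro j hj z r
  rw [tildIter_mgauge, uLev_glev L hL U₀ U₁ k j hj.le]
  have h := (eq72_iff_eq76 (avgIter L U₀ j) (tildIter L U₀ U₁ j) (glev L hL U₀ U₁ k j) ((L : ℤ) • z)
    ((L : ℤ) • z + boxVec L r)).2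
  rw [add_sub_cancel_left] at h
  exact h (by rw [glev_block L hL U₀ U₁ hj z r, glev_centre L hL U₀ U₁ hj z])

/-- **Existence, averaging condition**: `u := glev … k 0` satisfies (81) `(\overline{R₀u}^k)(y) = 1`.
[cite: Balaban1985Averaging, (81) p.30, (87) p.31] -/
theorem eq81_glev (L : ℕ) (hL : 1 ≤ L) (U₀ U₁ : Site d → Fin d → 𝔸ˣ) (k : ℕ) (z : Site d) :
    uavg L U₀ (glev L hL U₀ U₁ k 0) k z = 1 := by
  rw [eq81_iff_eq87 L U₀ U₁ _ (axialGauge_glev L hL U₀ U₁ k) z,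
    congrFun (uLev_glev L hL U₀ U₁ k k le_rfl) z, glev_top]

/-- **EXISTENCE of the gauge fixing** (p. 30–31): for every background `U₀`, every configuration `U₁` (units of `𝔸`), every
`L ≥ 1` and every `k`, there is a gauge transformation `u` on `ℤ^d` such that `U′ = U₁^u` (moving frame (55) at `U₀`) satisfies
the block axial gauge conditions (64)/(66)/(67) at the levels `j < k` and the averaging condition (81) at level `k` — namely
`u = glev … k 0` ((77) for `j = k − 1` below the values (87)). No smallness, no unitarity needed: pure algebra.
[cite: Balaban1985Averaging, (77)–(81) p.30, (87) p.31] -/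
theorem gaugeFixing_exists (L : ℕ) (hL : 1 ≤ L) (U₀ U₁ : Site d → Fin d → 𝔸ˣ) (k : ℕ) :
    ∃ u : Site d → 𝔸ˣ, AxialGauge L U₀ U₁ u k ∧ ∀ z : Site d, uavg L U₀ u k z = 1 :=
  ⟨glev L hL U₀ U₁ k 0, axialGauge_glev L hL U₀ U₁ k, eq81_glev L hL U₀ U₁ k⟩

omit [NormedAlgebra ℂ 𝔸] [CompleteSpace 𝔸] in
/-- `R(X)` is injective ((57): it has the two-sided inverse `R(X⁻¹)`). [cite: Balaban1985Averaging, (57) p.27] -/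
theorem Rc_injective (X : 𝔸ˣ) : Function.Injective (Rc X) := fun a b h => by
  simpa only [(Rc_inv_apply X _).1] using congrArg (Rc X⁻¹) h

/-- **UNIQUENESS of the gauge fixing** (p. 31: "Thus the gauge transformation is uniquely determined by all the
conditions"): two gauge transformations satisfying the block axial gauge conditions (67) at the levels `j < k` and the
averaging condition (81) at level `k` (same `U₀`, `U₁`, `L ≥ 1`) are EQUAL on all of `ℤ^d`. Proof as printed: (87) pins `u` on
`Ω^{(k)}`, and (76) pins `u` on each block of level `j` given its value at the block centre, downward in `j`.
[cite: Balaban1985Averaging, (76)–(77) p.29–30, (86)–(87) p.31] -/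
theorem gaugeFixing_unique (L : ℕ) (hL : 1 ≤ L) (U₀ U₁ : Site d → Fin d → 𝔸ˣ) (k : ℕ) {u u' : Site d → 𝔸ˣ}
    (hax : AxialGauge L U₀ U₁ u k) (h81 : ∀ z : Site d, uavg L U₀ u k z = 1)
    (hax' : AxialGauge L U₀ U₁ u' k) (h81' : ∀ z : Site d, uavg L U₀ u' k z = 1) : u = u' := by
  have key : ∀ i ≤ k, uLev L u (k - i) = uLev L u' (k - i) := by
    intro i
    induction i with
    | zero =>
      intro _
      funext z
      rw [Nat.sub_zero, (eq81_iff_eq87 L U₀ U₁ u hax z).1 (h81 z), (eq81_iff_eq87 L U₀ U₁ u' hax' z).1 (h81' z)]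
    | succ i ih =>
      intro hi
      have hj : k - (i + 1) < k := by omega
      have hj1 : k - (i + 1) + 1 = k - i := by omega
      funext x
      have e := eq76_of_axialGauge L U₀ U₁ u hax hj (fl L x) (brem L hL x)
      have e' := eq76_of_axialGauge L U₀ U₁ u' hax' hj (fl L x) (brem L hL x)
      rw [fl_decomp hL x] at e e'
      have hc : uLev L u (k - (i + 1)) ((L : ℤ) • fl L x) = uLev L u' (k - (i + 1)) ((L : ℤ) • fl L x) := by
        rw [uLev_smul, uLev_smul, hj1, ih (by omega)]
      rw [hc, ← e', R0fun_apply, R0fun_apply] at e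
      exact Rc_injective _ e
  have h := key k le_rfl
  rwa [Nat.sub_self, uLev_zero, uLev_zero] at h

/-- **The gauge fixing determines the average**: for THE gauge-fixed field `U′ = U₁^u`, `u = glev … k 0`, the `k`-fold average
relative to the background is the explicit double-bar average, `(\overline{U′U₀})^k(Ū₀^k)⁻¹ = U̿₁^k` (88)/(92) — unconditionally.
[cite: Balaban1985Averaging, (88) p.31, (92) p.31] -/
theorem eq88_glev (L : ℕ) (hL : 1 ≤ L) (U₀ U₁ : Site d → Fin d → 𝔸ˣ) (k : ℕ) :
    tildIter L U₀ (mgauge U₀ (glev L hL U₀ U₁ k 0) U₁) k = dbavgCovIter L U₀ U₁ k :=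
  eq88 L U₀ U₁ _ k (axialGauge_glev L hL U₀ U₁ k) (eq81_glev L hL U₀ U₁ k)

/-- … and for the full average: `\overline{(U₁^u·U₀)}^k = U̿₁^k·Ū₀^k` with `u = glev … k 0`.
[cite: Balaban1985Averaging, (88) p.31, (43) p.23] -/
theorem avgIter_glev (L : ℕ) (hL : 1 ≤ L) (U₀ U₁ : Site d → Fin d → 𝔸ˣ) (k : ℕ) :
    avgIter L (mgauge U₀ (glev L hL U₀ U₁ k 0) U₁ * U₀) k = dbavgCovIter L U₀ U₁ k * avgIter L U₀ k :=
  avgIter_eq_of_gauge L U₀ U₁ _ k (axialGauge_glev L hL U₀ U₁ k) (eq81_glev L hL U₀ U₁ k)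

end GaugeFixing

end Averaging

/-! ## §5 (v1.1) The telescoped multi-level contour formula (77)

Print, p. 29 (last display) and p. 30 (77): "Let us denote `U₀(Γ^{(j)}_{x_j,x}) = Ū₀^{j−1}(Γ_{x_j,x_{j−1}})·…·Ū₀(Γ_{x₂,x₁})U₀(Γ_{x₁,x})`,
then `(R̄^j_{0,x_{j+1}}R̄^{j−1}_{0,x_j}·…·R̄_{0,x₂}R_{0,x₁}u)(x) = R(U₀(Γ^{(j+1)}_{x_{j+1},x}))u(x)`, and we have the equality
`R(U₀(Γ^{(j+1)}_{x_{j+1},x}))u(x) = u(x_{j+1})(R̄^j_{0,x_{j+1}}Ũ^j_1)(Γ_{x_{j+1},x_j})R̄^j_{0,x_{j+1}}·(R̄^{j−1}_{0,x_j}Ũ^{j−1}_1)(Γ_{x_j,x_{j−1}})·…·R̄^j_{0,x_{j+1}}·…·R̄_{0,x₂}`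
`·(R_{0,x₁}U₁)(Γ_{x₁,x}) = u(x_{j+1})(R̄^j_{0,x_{j+1}}Ũ^j_1)(Γ_{x_{j+1},x_j})·R(Ū^j_0(Γ^{(1)}_{x_{j+1},x_j}))(R̄^{j−1}_{0,x_j}Ũ^{j−1}_1)(Γ_{x_j,x_{j−1}})·…`
`·R(Ū₀(Γ^{(j)}_{x_{j+1},x₁}))(R_{0,x₁}U₁)(Γ_{x₁,x}) = u(x_{j+1})(R_{0,x_{j+1}}U₁)(Γ^{(j+1)}_{x_{j+1},x}), x ∈ B^{j+1}(x_{j+1}), (77)`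
where the symbol `(R_{0,x_{j+1}}U₁)(Γ^{(j+1)}_{x_{j+1},x})` is defined by the last equation."

Here `x = x₀ ∈ Ω`, `x_{i+1}` is the centre of the block containing `x_i` (`x_i = (fl L)^[i] x` in level-`i` coordinates), the
telescoped transporter `U₀(Γ^{(m)}_{x_m,x})` is `telHol … m x` (top level leftmost, as printed) and the symbol
`(R_{0,x_m}U₁)(Γ^{(m)}_{x_m,x})` is `telTw … m x`, defined — as print says — by the last expression of (77), i.e. by the
recursion `T_{m+1}(x) = (R̄^m_{0,x_{m+1}}Ũ^m_1)(Γ_{x_{m+1},x_m}) · R(Ū₀^m(Γ_{x_{m+1},x_m}))[T_m(x)]` that generates print's product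
(`R` is multiplicative, (56)/(57)). `eq77` is (77) at every level `m ≤ k` under the gauge conditions (67) at the levels
`< k`; `gauge_formula` is print's "(77) for `j = k − 1` and (87)": the closed formula for the gauge fixing, and
`glev_formula` identifies the §4 construction with it. The operator form of the middle expression of (77) (the iterated
`R̄` symbols acting on everything to their right) is notation for the same product (`telRot_succ`). -/

section Telescoped

variable {𝔸 : Type*} [NormedRing 𝔸] [NormedAlgebra ℂ 𝔸] [CompleteSpace 𝔸]

/-- **`U₀(Γ^{(m)}_{x_m,x})`** — the telescoped parallel transporter from `x` up through the block centres
`x₁, …, x_m`: `U₀(Γ^{(m)}_{x_m,x}) = Ū₀^{m−1}(Γ_{x_m,x_{m−1}})·…·Ū₀(Γ_{x₂,x₁})U₀(Γ_{x₁,x})` (p. 29, the display before (77)),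
with `x_i = (fl L)^[i] x` and `Γ_{x_{i+1},x_i}` the tree contour of the block (`treeWord (boxVec L (brem x_i))` based at
`L·x_{i+1}` in level-`i` coordinates). [cite: Balaban1985Averaging, p.29 (display before (77)), (77) p.30] -/
def telHol (L : ℕ) (hL : 1 ≤ L) (U₀ : Site d → Fin d → 𝔸ˣ) : ℕ → Site d → 𝔸ˣ
  | 0 => fun _ => 1
  | m + 1 => fun x =>
      hol (avgIter L U₀ m) ((L : ℤ) • fl L ((fl L)^[m] x)) (treeWord (boxVec L (brem L hL ((fl L)^[m] x))))
        * telHol L hL U₀ m x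

/-- **`(R_{0,x_m}U₁)(Γ^{(m)}_{x_m,x})`** — the symbol "defined by the last equation" of (77): `T₀ = 1`,
`T_{m+1}(x) = (R̄^m_{0,x_{m+1}}Ũ^m_1)(Γ_{x_{m+1},x_m}) · R(Ū₀^m(Γ_{x_{m+1},x_m}))[T_m(x)]`, which expands to print's product
`(R̄^m_{0,x_{m+1}}Ũ^m_1)(Γ_{x_{m+1},x_m})·R(Ū^m_0(Γ^{(1)}_{x_{m+1},x_m}))(R̄^{m−1}_{0,x_m}Ũ^{m−1}_1)(Γ_{x_m,x_{m−1}})·…·R(Ū₀(Γ^{(m)}_{x_{m+1},x₁}))(R_{0,x₁}U₁)(Γ_{x₁,x})`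
by the multiplicativity (56)/(57) of `R`. [cite: Balaban1985Averaging, (77) p.30] -/
def telTw (L : ℕ) (hL : 1 ≤ L) (U₀ U₁ : Site d → Fin d → 𝔸ˣ) : ℕ → Site d → 𝔸ˣ
  | 0 => fun _ => 1
  | m + 1 => fun x =>
      tHol (avgIter L U₀ m) (tildIter L U₀ U₁ m) ((L : ℤ) • fl L ((fl L)^[m] x))
          (treeWord (boxVec L (brem L hL ((fl L)^[m] x))))
        * Rc (hol (avgIter L U₀ m) ((L : ℤ) • fl L ((fl L)^[m] x)) (treeWord (boxVec L (brem L hL ((fl L)^[m] x)))))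
            (telTw L hL U₀ U₁ m x)

/-- `telHol … 0 x = 1` (empty contour). [cite: Balaban1985Averaging, (77) p.30] -/
@[simp] theorem telHol_zero (L : ℕ) (hL : 1 ≤ L) (U₀ : Site d → Fin d → 𝔸ˣ) (x : Site d) :
    telHol L hL U₀ 0 x = 1 := rfl

/-- `U₀(Γ^{(m+1)}_{x_{m+1},x}) = Ū₀^m(Γ_{x_{m+1},x_m})·U₀(Γ^{(m)}_{x_m,x})` (top level on the left, as printed).
[cite: Balaban1985Averaging, p.29 (display before (77))] -/
theorem telHol_succ (L : ℕ) (hL : 1 ≤ L) (U₀ : Site d → Fin d → 𝔸ˣ) (m : ℕ) (x : Site d) :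
    telHol L hL U₀ (m + 1) x
      = hol (avgIter L U₀ m) ((L : ℤ) • fl L ((fl L)^[m] x)) (treeWord (boxVec L (brem L hL ((fl L)^[m] x))))
          * telHol L hL U₀ m x := rfl

/-- `telTw … 0 x = 1`. [cite: Balaban1985Averaging, (77) p.30] -/
@[simp] theorem telTw_zero (L : ℕ) (hL : 1 ≤ L) (U₀ U₁ : Site d → Fin d → 𝔸ˣ) (x : Site d) :
    telTw L hL U₀ U₁ 0 x = 1 := rfl

/-- The recursion generating print's product in (77). [cite: Balaban1985Averaging, (77) p.30] -/
theorem telTw_succ (L : ℕ) (hL : 1 ≤ L) (U₀ U₁ : Site d → Fin d → 𝔸ˣ) (m : ℕ) (x : Site d) :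
    telTw L hL U₀ U₁ (m + 1) x
      = tHol (avgIter L U₀ m) (tildIter L U₀ U₁ m) ((L : ℤ) • fl L ((fl L)^[m] x))
            (treeWord (boxVec L (brem L hL ((fl L)^[m] x))))
          * Rc (hol (avgIter L U₀ m) ((L : ℤ) • fl L ((fl L)^[m] x)) (treeWord (boxVec L (brem L hL ((fl L)^[m] x)))))
              (telTw L hL U₀ U₁ m x) := rfl

/-- The operator identity before (77): "`(R̄^j_{0,x_{j+1}}R̄^{j−1}_{0,x_j}·…·R̄_{0,x₂}R_{0,x₁}u)(x) = R(U₀(Γ^{(j+1)}_{x_{j+1},x}))u(x)`"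
— composing one more level rotation `R(Ū₀^m(Γ_{x_{m+1},x_m}))` with the rotation by `U₀(Γ^{(m)}_{x_m,x})` is the rotation by
`U₀(Γ^{(m+1)}_{x_{m+1},x})`, by (57) `R(X)R(Y) = R(XY)`. [cite: Balaban1985Averaging, p.29 (display before (77)), (57) p.27] -/
theorem telRot_succ (L : ℕ) (hL : 1 ≤ L) (U₀ : Site d → Fin d → 𝔸ˣ) (m : ℕ) (x : Site d) (X : 𝔸ˣ) :
    Rc (telHol L hL U₀ (m + 1) x) X
      = Rc (hol (avgIter L U₀ m) ((L : ℤ) • fl L ((fl L)^[m] x)) (treeWord (boxVec L (brem L hL ((fl L)^[m] x)))))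
          (Rc (telHol L hL U₀ m x) X) := by
  rw [telHol_succ, Rc_mul, MonoidHom.comp_apply]

/-- **(77)** at every level: under the block axial gauge conditions (67) at the levels `j < k`, for every `m ≤ k` and every
site `x`, `R(U₀(Γ^{(m)}_{x_m,x}))u(x) = u(x_m)·(R_{0,x_m}U₁)(Γ^{(m)}_{x_m,x})` (`u(x_m)` = `uLev L u m x_m`, `x_m = (fl L)^[m] x`).
Print's proof: iterate (76) — each step is (76) at level `m` for the block point `x_m ∈ B(x_{m+1})`, conjugated by the
rotation accumulated so far, using the multiplicativity of `R`. The case `m = 1` is (73), `m = 2` is (75).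
[cite: Balaban1985Averaging, (77) p.30, (73)–(76) p.29] -/
theorem eq77 (L : ℕ) (hL : 1 ≤ L) (U₀ U₁ : Site d → Fin d → 𝔸ˣ) (u : Site d → 𝔸ˣ) {k : ℕ}
    (hax : AxialGauge L U₀ U₁ u k) :
    ∀ m ≤ k, ∀ x : Site d,
      Rc (telHol L hL U₀ m x) (u x) = uLev L u m ((fl L)^[m] x) * telTw L hL U₀ U₁ m x := by
  intro m
  induction m with
  | zero =>
    intro _ x
    simp
  | succ m ih =>
    intro hm x
    have e := eq76_of_axialGauge L U₀ U₁ u hax (show m < k by omega) (fl L ((fl L)^[m] x))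
      (brem L hL ((fl L)^[m] x))
    rw [R0fun_add, fl_decomp hL, uLev_smul] at e
    rw [telRot_succ, ih (by omega) x, map_mul, e, telTw_succ, Function.iterate_succ_apply', mul_assoc]

/-- **"(77) for `j = k − 1` and (87)"** (p. 31: "the gauge transformation is uniquely determined by all the conditions and is
given by the formulas (77) for `j = k − 1` and by (87)"): a gauge transformation satisfying (67) at the levels `j < k` and the
averaging condition (81) at level `k` is given in closed form by
`u(x) = R(U₀(Γ^{(k)}_{x_k,x}))⁻¹[(\overline{R_{0,x_k}U₁^{(k)}})⁻¹ · (R_{0,x_k}U₁)(Γ^{(k)}_{x_k,x})]`, `x_k = (fl L)^[k] x`.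
[cite: Balaban1985Averaging, (77) p.30, (87) p.31] -/
theorem gauge_formula (L : ℕ) (hL : 1 ≤ L) (U₀ U₁ : Site d → Fin d → 𝔸ˣ) {u : Site d → 𝔸ˣ} {k : ℕ}
    (hax : AxialGauge L U₀ U₁ u k) (h81 : ∀ z : Site d, uavg L U₀ u k z = 1) (x : Site d) :
    u x = Rc (telHol L hL U₀ k x)⁻¹
      ((wrec L U₀ U₁ k ((fl L)^[k] x))⁻¹ * telTw L hL U₀ U₁ k x) := by
  have h := eq77 L hL U₀ U₁ u hax k le_rfl x
  rw [(eq81_iff_eq87 L U₀ U₁ u hax _).1 (h81 _)] at h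
  rw [← h, (Rc_inv_apply _ _).1]

/-- The §4 construction IS print's formula: `glev … k 0 x = R(U₀(Γ^{(k)}_{x_k,x}))⁻¹[(\overline{R_{0,x_k}U₁^{(k)}})⁻¹·(R_{0,x_k}U₁)(Γ^{(k)}_{x_k,x})]`.
[cite: Balaban1985Averaging, (77) p.30, (87) p.31] -/
theorem glev_formula (L : ℕ) (hL : 1 ≤ L) (U₀ U₁ : Site d → Fin d → 𝔸ˣ) (k : ℕ) (x : Site d) :
    glev L hL U₀ U₁ k 0 x = Rc (telHol L hL U₀ k x)⁻¹
      ((wrec L U₀ U₁ k ((fl L)^[k] x))⁻¹ * telTw L hL U₀ U₁ k x) :=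
  gauge_formula L hL U₀ U₁ (axialGauge_glev L hL U₀ U₁ k) (eq81_glev L hL U₀ U₁ k) x

end Telescoped

end Literature.MathematicalPhysics.QuantumFieldTheory.Balaban1983to89.B7Eq84Concrete
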